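import Literature.Probability.Percolation.TriSubcriticalCrossing
import Literature.Probability.Percolation.TriThetaHalf
import HarnessLib

/-!
# Exponential decay of the radius below `1/2` on `𝕋`: discharge of `BollobasRiordan2006_tri_expDecay`

Topic `Literature/Probability/Percolation`; family `crit-perc`. Proofs only. The named fact
`Literature.Probability.Percolation.BollobasRiordan2006_tri_expDecay` (`TriSubcriticalCrossing.lean`; Bollobás–Riordan
2006, Ch. 4, Thm. 9 with Ch. 5, Thm. 8: for site percolation on `𝕋` and `p < 1/2` there is
`α > 0` with `P_p(0 ↔ ∂Λ_n) ≤ e^{-α n}` for all `n ≥ 1`) is PROVED from the tree's sharpness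
machinery, following Bollobás–Riordan's route "`p_c^s(T) = 1/2` + Menshikov/Aizenman–Barsky
exponential decay below `p_c`" with Menshikov's theorem replaced by the Duminil-Copin–Tassion
argument in its site version:

* `exists_dctPhi_lt_one_of_lt_half` — for `p < 1/2` there are `q ∈ [p, 1/2]` and a finite
  `S ∋ 0` with `ψ_q(S) < 1`: otherwise the mean-field bound `siteTheta_ge_meanField`
  (`SiteSharpnessMeanField.lean`; Duminil-Copin–Tassion 2016, Thm. 1.1, item 2) on `[p₀, 1/2]`,
  `p₀ = max p (1/4)`, would give `θ(1/2) ≥ (1/2 - p₀)/(1 - p₀) > 0`, contradicting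
  `θ(1/2) = 0` (`triTheta_half_holds`, `TriThetaHalf.lean`; Kesten 1982, §3.4 (3.43));
* `triOneArm_subset_exitEvent_box` — `{0 ↔ ∂Λ_n} ⊆ {0 ⟷ ∂ⁱⁿB(m) in B(m)}` for `2m + 2 ≤ n`
  (the sup-norm box `B(m) = box 2 m` lies inside the hexagon `Λ_{2m+1}`; first exit of the arm
  from `B(m)`, `PathIn.exit`);
* `BollobasRiordan2006_tri_expDecay_holds` — the discharge: `P_p(0 ↔ ∂Λ_n) ≤ P_p(0 ⟷ ∂ⁱⁿB(kL))
  ≤ P_q(0 ⟷ ∂ⁱⁿB(kL)) ≤ c^k` (`tri_exists_exp_decay_of_dctPhi_lt_one`, `SiteSharpnessDecay.lean`,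
  Duminil-Copin–Tassion 2016, Thm. 1.1, item 1; monotonicity in `p`, `sitePercolation_real_mono`)
  with `k = ⌊((n-1)/2)/L⌋`, together with the trivial bound `P_p(0 ↔ ∂Λ_n) ≤ P_p(0 open) = p < 1`
  for the finitely many small `n`, repackaged as a single rate `e^{-α n}`, `n ≥ 1`.

## References

* B. Bollobás, O. Riordan, *Percolation*, CUP 2006, Ch. 4, Thm. 9; Ch. 5, Thm. 8
  [BollobasRiordan2006].
* H. Duminil-Copin, V. Tassion, *Enseign. Math.* 62 (2016), Thm. 1.1 [DuminilCopinTassionEM2016].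
* H. Kesten, *Percolation theory for mathematicians* (1982), §3.4 [KestenPTM1982].

Mathlib: `Real.exp`, `Real.log`, `Nat.ceil`; no percolation. Tree: `siteTheta_ge_meanField`
(`SiteSharpnessMeanField.lean`), `tri_exists_exp_decay_of_dctPhi_lt_one`, `exitEvent_anti`
(`SiteSharpnessDecay.lean`), `triTheta_half_holds` (`TriThetaHalf.lean`), `exitEvent`,
`isUpperSet_exitEvent`, `determinedBy_exitEvent`, `sitePercolation_real_mono`
(`SiteMonotonicity.lean`), `PathIn.exit`, `PathIn.of_mem_siteConnIn`, `PathIn.mem_siteConnIn`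
(`SitePaths.lean`), `sitePercolation_real_mem` (`SitePercolationMeasure.lean`), `triOneArm`,
`triSphere`, `triBall`, `triNorm` (`TriangularLattice.lean`), `box` (`ThermodynamicLimit.lean`).
-/

noncomputable section

open MeasureTheory Set Filter Topology
open scoped unitInterval

namespace Literature.Probability.Percolation

open LatticeModels

/-! ### A finite set with `ψ_q(S) < 1` for some `q ∈ [p, 1/2]` -/

/-- **Below `1/2` the DCT functional drops below `1`**: for `p < 1/2` there are `q` with
`p ≤ q` and a finite `S ∋ 0` with `ψ_q(S) < 1`. Otherwise `ψ_q(S) ≥ 1` for all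
`q ∈ [max p (1/4), 1/2]` and all finite `S ∋ 0`, and the mean-field bound gives
`θ(1/2) ≥ (1/2 - p₀)/(1 - p₀) > 0`, contradicting `θ(1/2) = 0`. (Bollobás–Riordan 2006, Ch. 5,
Thm. 8 with Ch. 4, Thm. 7 (Menshikov: `p_T = p_H`); here via Duminil-Copin–Tassion 2016, Thm. 1.1,
item 2.) [cite: BollobasRiordan2006, Ch. 5, Thm. 8 (proof) with Ch. 4, Thm. 7] -/
theorem exists_dctPhi_lt_one_of_lt_half {p : unitInterval} (hp : (p : ℝ) < 1 / 2) :
    ∃ q : unitInterval, (p : ℝ) ≤ q ∧ ∃ S : Finset (Site 2), (0 : Site 2) ∈ S ∧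
      dctPhi triGraph q S 0 < 1 := by
  by_contra! hcon
  set p₀ : ℝ := max (p : ℝ) (1 / 4) with hp₀
  have hp₀0 : 0 < p₀ := lt_max_of_lt_right (by norm_num)
  have hp₀h : p₀ < 1 / 2 := max_lt hp (by norm_num)
  have hhalf : ((half : unitInterval) : ℝ) = 1 / 2 := rfl
  have hmf := siteTheta_ge_meanField (G := triGraph) (0 : Site 2) hp₀0 (p := half)
    (by rw [hhalf]; exact hp₀h.le) (by rw [hhalf]; norm_num)
    (fun q hq _ S h0S => hcon q ((le_max_left _ _).trans hq) S h0S)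
  have hpos : 0 < (((half : unitInterval) : ℝ) - p₀) / (1 - p₀) :=
    div_pos (by rw [hhalf]; linarith) (by linarith)
  have hθ : siteTheta triGraph (0 : Site 2) half = 0 := triTheta_half_holds
  linarith [hmf, hpos, hθ]

/-! ### One-arm events and exit events of sup-norm boxes -/

/-- Sites of the sup-norm box `B(m)` have `𝕋`-norm at most `2m`. [folklore] -/
theorem triNorm_le_of_mem_box {m : ℕ} {z : Site 2} (hz : z ∈ box 2 m) : triNorm z ≤ 2 * m := by
  have h0 := mem_box.1 hz 0
  have h1 := mem_box.1 hz 1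
  simp only [triNorm, max_le_iff]
  refine ⟨?_, ?_, ?_⟩
  · rw [abs_le]; omega
  · rw [abs_le]; omega
  · rw [abs_le]; omega

/-- **`{0 ↔ ∂Λ_n} ⊆ {0 ⟷ ∂ⁱⁿB(m) in B(m)}` for `2m + 1 ≤ n`**: an open path in `Λ_n` from `0`
to the sphere `∂Λ_n` leaves the box `B(m) ⊆ Λ_{2m}`; stop it at its first exit (`PathIn.exit`).
[folklore] -/
theorem triOneArm_subset_exitEvent_box {m n : ℕ} (h : 2 * m + 1 ≤ n) :
    triOneArm n ⊆ exitEvent triGraph (box 2 m) 0 := by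
  intro ω hω
  obtain ⟨y, hy, hconn⟩ := hω
  have hpath := PathIn.of_mem_siteConnIn hconn
  have hyn : triNorm y = n := (Finset.mem_filter.1 hy).2
  have hy' : y ∉ (↑(box 2 m) : Set (Site 2)) := by
    intro hyb
    have := triNorm_le_of_mem_box (Finset.mem_coe.1 hyb)
    omega
  obtain ⟨a, b, ha, hb, -, hab, hpa⟩ :=
    hpath.exit (R := (↑(box 2 m) : Set (Site 2))) (Finset.mem_coe.2 (zero_mem_box 2 m)) hy'
  refine mem_exitEvent_iff.2 ⟨a, mem_innerBoundary_iff.2 ⟨Finset.mem_coe.1 ha, b,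
    fun hb' => hb (Finset.mem_coe.2 hb'), hab⟩, ?_⟩
  refine (hpa.mono ?_).mem_siteConnIn
  rintro z ⟨hzR, -, hzω⟩
  exact ⟨hzR, hzω⟩

/-- The one-arm event requires the origin to be open: `P_p(0 ↔ ∂Λ_n) ≤ p`. [folklore] -/
theorem real_triOneArm_le_self (p : unitInterval) (n : ℕ) :
    (triSitePercolation p).real (triOneArm n) ≤ p := by
  have hsub : triOneArm n ⊆ {ω : SiteConfig (Site 2) | (0 : Site 2) ∈ ω} := by
    rintro ω ⟨y, -, hconn⟩
    exact (PathIn.of_mem_siteConnIn hconn).left_mem.2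
  calc (triSitePercolation p).real (triOneArm n)
      ≤ (triSitePercolation p).real {ω : SiteConfig (Site 2) | (0 : Site 2) ∈ ω} :=
        measureReal_mono hsub (measure_ne_top _ _)
    _ = p := sitePercolation_real_mem p (0 : Site 2)

/-! ### The discharge -/

/-- **Geometric decay in blocks**: for `p < 1/2` there are `L ≥ 1` and `c ∈ [1/2, 1)` with
`P_p(0 ↔ ∂Λ_n) ≤ c^k` whenever `2 k L + 1 ≤ n`. (Duminil-Copin–Tassion 2016, Thm. 1.1, item 1,
site version on `𝕋`, transported from a `q ∈ [p, 1/2]` with `ψ_q(S) < 1` by monotonicity.)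
[cite: DuminilCopinTassionEM2016, Thm. 1.1 item 1] -/
theorem real_triOneArm_le_pow_of_lt_half {p : unitInterval} (hp : (p : ℝ) < 1 / 2) :
    ∃ L : ℕ, 1 ≤ L ∧ ∃ c : ℝ, 1 / 2 ≤ c ∧ c < 1 ∧ ∀ k n : ℕ, 2 * (k * L) + 1 ≤ n →
      (triSitePercolation p).real (triOneArm n) ≤ c ^ k := by
  obtain ⟨q, hpq, S, h0S, hψ⟩ := exists_dctPhi_lt_one_of_lt_half hp
  obtain ⟨L, hL, c, hc0, hc1, hdec⟩ := tri_exists_exp_decay_of_dctPhi_lt_one q h0S hψ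
  refine ⟨L, hL, max c (1 / 2), le_max_right _ _, max_lt hc1 (by norm_num), fun k n hkn => ?_⟩
  have hpq' : p ≤ q := hpq
  calc (triSitePercolation p).real (triOneArm n)
      ≤ (sitePercolation (Site 2) p).real (exitEvent triGraph (box 2 (k * L)) 0) :=
        measureReal_mono (triOneArm_subset_exitEvent_box hkn) (measure_ne_top _ _)
    _ ≤ (sitePercolation (Site 2) q).real (exitEvent triGraph (box 2 (k * L)) 0) :=
        sitePercolation_real_mono (determinedBy_exitEvent _ _) (isUpperSet_exitEvent _ _) hpq'
    _ ≤ c ^ k := hdec k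
    _ ≤ max c (1 / 2) ^ k := pow_le_pow_left₀ hc0 (le_max_left _ _) k

/-- **Exponential decay of the radius below `1/2` on `𝕋`** — discharge of the named fact
`BollobasRiordan2006_tri_expDecay` (Bollobás–Riordan 2006, Ch. 4, Thm. 9 with Ch. 5, Thm. 8):
for every `p < 1/2` there is `α > 0` with `P_p(0 ↔ ∂Λ_n) ≤ e^{-α n}` for all `n ≥ 1`. From
`real_triOneArm_le_pow_of_lt_half`: with `k = ⌊⌊(n-1)/2⌋/L⌋ ≥ n/(2L) - 1` and `c ≥ 1/2`,
`c^k ≤ 2 e^{-γ n}`, `γ = log(1/c)/(2L)`; together with `P_p(0 ↔ ∂Λ_n) ≤ p < 1/2`,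
`P_p(0 ↔ ∂Λ_n)² ≤ p · 2 e^{-γ n} ≤ e^{-γ n}`, so `α = γ/2` works for all `n ≥ 1`.
[cite: BollobasRiordan2006, Ch. 4, Thm. 9, with Ch. 5, Thm. 8 and Ch. 4, Thm. 7] -/
theorem BollobasRiordan2006_tri_expDecay_holds : BollobasRiordan2006_tri_expDecay := by
  intro p hp
  obtain ⟨L, hL, c, hc0, hc1, hdec⟩ := real_triOneArm_le_pow_of_lt_half hp
  have hcpos : 0 < c := by linarith
  have hLpos : (0 : ℝ) < L := by exact_mod_cast hL
  -- the rate `β = log (1/c) ∈ (0, log 2]` per block, `γ = β / (2L)` per unit length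
  set β : ℝ := -Real.log c with hβ
  have hβ0 : 0 < β := by rw [hβ, neg_pos]; exact Real.log_neg hcpos hc1
  have hβ2 : β ≤ Real.log 2 := by
    have h := Real.log_le_log (by norm_num : (0 : ℝ) < 1 / 2) hc0
    rw [one_div, Real.log_inv] at h
    rw [hβ]; linarith
  set γ : ℝ := β / (2 * L) with hγ
  have hγ0 : 0 < γ := by positivity
  have hγL : γ * (2 * L) = β := by rw [hγ]; field_simp
  -- block bound: `P ≤ 2 e^{-γ n}` for all `n ≥ 1`
  have hblock : ∀ n : ℕ, 1 ≤ n →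
      (triSitePercolation p).real (triOneArm n) ≤ 2 * Real.exp (-(γ * n)) := by
    intro n hn
    set d : ℕ := (n - 1) / 2 with hd
    set k : ℕ := d / L with hk
    have hd2 : n ≤ 2 * d + 2 := by
      have h1 := Nat.div_add_mod (n - 1) 2
      have h2 := Nat.mod_lt (n - 1) (show 0 < 2 by norm_num)
      rw [← hd] at h1
      omega
    have hkL : d + 1 ≤ L * k + L := by
      have h1 := Nat.div_add_mod d L
      have h2 := Nat.mod_lt d (show 0 < L by omega)
      rw [← hk] at h1
      omega
    have hkn : 2 * (k * L) + 1 ≤ n := by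
      have h1 : d / L * L ≤ d := Nat.div_mul_le_self _ _
      have h2 : (n - 1) / 2 * 2 ≤ n - 1 := Nat.div_mul_le_self _ _
      rw [← hk] at h1
      rw [← hd] at h2
      omega
    have hreal : (n : ℝ) ≤ 2 * L * k + 2 * L := by
      have h1 : (n : ℝ) ≤ 2 * d + 2 := by exact_mod_cast hd2
      have h2 : (d : ℝ) + 1 ≤ L * k + L := by exact_mod_cast hkL
      linarith
    -- `β k ≥ γ n - β ≥ γ n - log 2`
    have hk_lb : γ * n ≤ β * k + β :=
      calc γ * n ≤ γ * (2 * L * k + 2 * L) := mul_le_mul_of_nonneg_left hreal hγ0.le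
        _ = β * k + β := by rw [← hγL]; ring
    have hck : c ^ k = Real.exp (Real.log c * k) := by
      rw [← Real.rpow_natCast, Real.rpow_def_of_pos hcpos]
    calc (triSitePercolation p).real (triOneArm n) ≤ c ^ k := hdec k n hkn
      _ = Real.exp (Real.log c * k) := hck
      _ ≤ Real.exp (Real.log 2 + -(γ * n)) := by
          rw [Real.exp_le_exp]
          have : Real.log c = -β := by rw [hβ, neg_neg]
          rw [this]
          linarith
      _ = 2 * Real.exp (-(γ * n)) := by rw [Real.exp_add, Real.exp_log (by norm_num)]
  -- `α = γ / 2`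
  refine ⟨γ / 2, by positivity, fun n hn => ?_⟩
  have hP0 : 0 ≤ (triSitePercolation p).real (triOneArm n) := measureReal_nonneg
  have hsq : (triSitePercolation p).real (triOneArm n) ^ 2 ≤ Real.exp (-(γ / 2) * n) ^ 2 := by
    have h2 : Real.exp (-(γ / 2) * n) ^ 2 = Real.exp (-(γ * n)) := by
      rw [← Real.exp_nat_mul]; congr 1; push_cast; ring
    rw [h2, sq]
    calc (triSitePercolation p).real (triOneArm n) * (triSitePercolation p).real (triOneArm n)
        ≤ (p : ℝ) * (2 * Real.exp (-(γ * n))) :=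
          mul_le_mul (real_triOneArm_le_self p n) (hblock n hn) hP0 p.2.1
      _ ≤ 1 / 2 * (2 * Real.exp (-(γ * n))) :=
          mul_le_mul_of_nonneg_right hp.le (by positivity)
      _ = Real.exp (-(γ * n)) := by ring
  exact (pow_le_pow_iff_left₀ hP0 (Real.exp_pos _).le two_ne_zero).1 hsq

end Literature.Probability.Percolation
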